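import Summits.QuantumFields.YangMills.Theorems.LuscherReductionOneSiteLevelsKacFlat
import Summits.QuantumFields.YangMills.Theorems.LuscherReductionOneSiteLevelsKacInner
import Summits.QuantumFields.YangMills.Theorems.LuscherReductionOneSiteLevelsValleyReduction
import Literature.Analysis.OperatorTheory.YangMillsMatrixModelAL1Holds
import HarnessLib

/-!
# `OneSiteTail` (item stmt-QuantumFields-20204), door 2, layer III in COUNT MODE: the flat Kac-form count

Support module for the split child `OneSiteTail` of crux `RunningReduction` (route `LuscherReduction`).
Companion of `…OneSiteTailInner` (count-mode layers I+II, `innerCount_of_flatKacCount : «FlatKacCount» → «INNERc»`).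
This file PROVES «FlatKacCount» (κ = 7): it is reduced to the elementary volume inequality on `ℝ⁹`

  «DimBoundPoly»  `∃ C p, 0 < C ∧ ∀ E ≥ 0, dimBound E ≤ C (1 + E) ^ p`

(`dimBound E = 8 · vol B(0, 2(6E + 4δ(E))) / vol B(0, δ(E)/2)`, `δ(E) = 1/(2(√(2E)+1))`, a ratio of Euclidean ball volumes,
hence `= 8 (48 E (√(2E)+1) + 16)⁹ ≤ 8·48⁹ (1+E)¹⁸`), which is then proved from `Measure.addHaar_closedBall'` (§6).

THE OBSERVATION (why no `e^{O(E)}` prefactor and no eigenfunction regularity enter).  In count mode the constraint family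
below energy `E` may be taken to be the WHOLE AL1 eigenfamily `f_0, …, f_m` below the window `physLevel (m+2) ≥ E + 4707`
(minimal such `m`; then `m ≤ dimBound (E + 4707)` by `le_physLevel_of_dimBound_lt`).  A datum `g ⊥ f_0, …, f_m` has NO span
component, so of the four constants of the flat lane (`K, Cc, D₀, t₀` of `flatKac_window`) only the remainder threshold
`t₀` survives, and `t₀` depends on the family only through the almost-orthogonality budget
`Θ = ¼ Σ_j ∫ ‖∇f_j‖² ≤ ½ Σ_j E_j ≤ ½ (m+1) · max (physLevel 1) (E + 4707)` (energy identity `𝔮(f_j) = E_j`, `V ≥ 0`) and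
through `physLevel (m+2)`, which the min–max step only uses from BELOW (so it may be replaced by `E + 4707`).  Hence
`1/t₀(E)` is a polynomial in `E` and «FlatKacCount» holds with deficit constant `C' = 0`.

Contents (all sorry-free):
* `sum_sq_integral_heatSmooth_mul_le_explicit` — the budget (H6e) with `Θ = ¼ Σ_j ∫‖fderiv f_j‖²` EXPOSED (copy of the
  tree proof of `sum_sq_integral_heatSmooth_mul_le`, [folklore]);
* `integral_norm_fderiv_sq_le` — `∫‖∇f_j‖² ≤ 2 E_j` [cite: ReedSimonIV1978, Thm. XIII.64];
* `kacForm_remainder_count` — III.10 with no span component and explicit threshold [cite: SimonB1983DiscreteSpectrum, §3];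
* `exists_window_index` — the minimal window index and its count [cite: SimonB1983DiscreteSpectrum, Cor. 4];
* `flatKacCount_of_dimBoundPoly` — «DimBoundPoly» → «FlatKacCount» (κ = 7, `C' = 0`);
* `dimBound_le_poly` — «DimBoundPoly» [cite: SimonB1983DiscreteSpectrum, Cor. 4]; ★★`flatKacCount` — «FlatKacCount».

With `OSTailInner.innerCount_of_flatKacCount`, `OSTailCount.femtoSubspaceBound_of_innerCount` and
`OSTailDoors.oneSiteTail_of_femtoSubspaceBound` this PROVES the route item:
`theorem oneSiteTail : Theses.LuscherReduction.OneSiteTail :=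
  OSTailDoors.oneSiteTail_of_femtoSubspaceBound (OSTailCount.femtoSubspaceBound_of_innerCount
    (OSTailInner.innerCount_of_flatKacCount OSTailFlat.flatKacCount))` (route decl body = conclusion, `Iff.rfl`).
Real analysis only; NOT a claim about the gap; femto rung of the Lüscher ladder.
-/

set_option autoImplicit false

noncomputable section

open MeasureTheory Filter Topology Asymptotics Real
open Literature.Analysis.OperatorTheory.YMMatrixModel

namespace Summit.QuantumFields.YangMills.Theorems.FemtoTransferGap.OSTailFlat

/-! ## 1. The almost-orthogonality budget with its constant exposed -/

/-- **H6e with the constant exposed**: `Σ_j ⟨P_{t/2} r, f_j⟩² ≤ t · (¼ Σ_j ∫‖∇f_j‖²) · ∫ r²` for `r ⊥ f_j`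
(bounded measurable integrable `r`, `0 < t`).  Same proof as `sum_sq_integral_heatSmooth_mul_le`. [folklore] -/
theorem sum_sq_integral_heatSmooth_mul_le_explicit {m : ℕ} {f : Fin (m + 1) → ZM → ℝ} (hf : IsEigenFamily m f) :
    ∀ t : ℝ, 0 < t → ∀ (r : ZM → ℝ), Measurable r → ∀ M : ℝ, (∀ x, |r x| ≤ M) → Integrable r →
      (∀ j, ∫ x, r x * f j x = 0) →
      ∑ j, (∫ x, heatSmooth (t / 2) r x * f j x) ^ 2 ≤
        t * ((1 / 4 : ℝ) * ∑ j, ∫ z, ‖fderiv ℝ (f j) z‖ ^ 2) * ∫ x, r x ^ 2 := by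
  obtain ⟨C, hC0, hC⟩ := exists_uniform_expDecay₂ hf.2.2.2.2
  have h0 : ∀ j z, ‖f j z‖ ≤ C := fun j z => by
    rw [Real.norm_eq_abs]
    exact ((hC j z).1).trans (by nlinarith [Real.exp_le_one_iff.mpr (neg_nonpos.mpr (norm_nonneg z)), Real.exp_pos (-‖z‖)])
  have h1 : ∀ j z, ‖fderiv ℝ (f j) z‖ ≤ 3 * (C * Real.exp (-‖z‖)) := fun j z =>
    norm_fderiv_le_of_pderiv_le (by positivity) (fun p => (hC j z).2.1 p)
  have h1' : ∀ j z, ‖fderiv ℝ (f j) z‖ ≤ 3 * C := fun j z =>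
    (h1 j z).trans (by nlinarith [Real.exp_le_one_iff.mpr (neg_nonpos.mpr (norm_nonneg z)), Real.exp_pos (-‖z‖)])
  have hf2 : ∀ j, Integrable fun z => f j z ^ 2 := fun j => (isKacFn_of_isEigenFamily hf j).integrable_sq
  have hD2 : ∀ j, Integrable fun z => ‖fderiv ℝ (f j) z‖ ^ 2 := fun j =>
    integrable_sq_of_le_exp ((hf.1 j 1).continuous_fderiv one_ne_zero).norm (A := 3 * C) (fun z => by
      rw [abs_of_nonneg (norm_nonneg _)]; linarith [h1 j z])
  intro t ht r hrm M hrb hri horth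
  have hr0 : 0 ≤ ∫ x, r x ^ 2 := integral_nonneg fun x => sq_nonneg _
  have hj : ∀ j, (∫ x, heatSmooth (t / 2) r x * f j x) ^ 2 ≤ (∫ x, r x ^ 2) * (t / 4 * ∫ z, ‖fderiv ℝ (f j) z‖ ^ 2) := by
    intro j
    have h := abs_integral_heatSmooth_mul_le (half_pos ht) hrm hrb hri (hf.1 j 1) (h0 j) (h1' j) (hf2 j) (hD2 j) (horth j)
    have hD0 : 0 ≤ ∫ z, ‖fderiv ℝ (f j) z‖ ^ 2 := integral_nonneg fun z => sq_nonneg _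
    have e : t / 2 / 2 * ∫ z, ‖fderiv ℝ (f j) z‖ ^ 2 = t / 4 * ∫ z, ‖fderiv ℝ (f j) z‖ ^ 2 := by ring
    rw [e] at h
    have hsq := pow_le_pow_left₀ (abs_nonneg _) h 2
    rw [sq_abs, mul_pow, Real.sq_sqrt hr0, Real.sq_sqrt (by positivity)] at hsq
    exact hsq
  calc ∑ j, (∫ x, heatSmooth (t / 2) r x * f j x) ^ 2
      ≤ ∑ j, (∫ x, r x ^ 2) * (t / 4 * ∫ z, ‖fderiv ℝ (f j) z‖ ^ 2) := Finset.sum_le_sum fun j _ => hj j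
    _ = t * ((1 / 4 : ℝ) * ∑ j, ∫ z, ‖fderiv ℝ (f j) z‖ ^ 2) * ∫ x, r x ^ 2 := by
        rw [← Finset.mul_sum, ← Finset.mul_sum]; ring

/-! ## 2. The energy identity bounds the budget by the levels -/

/-- `∫ ‖∇f_j‖² ≤ 2 E_j` for a member of an AL1 eigenfamily (`𝔮(f_j) = E_j`, `V ≥ 0`). [cite: ReedSimonIV1978, Thm. XIII.64] -/
theorem integral_norm_fderiv_sq_le {m : ℕ} {f : Fin (m + 1) → ZM → ℝ} (hf : IsEigenFamily m f) (j : Fin (m + 1)) :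
    ∫ z, ‖fderiv ℝ (f j) z‖ ^ 2 ≤ 2 * physLevel ((j : ℕ) + 1) := by
  have hK : IsKacFn (f j) := isKacFn_of_isEigenFamily hf j
  set c : Fin (m + 1) → ℝ := fun i => if i = j then (1 : ℝ) else 0 with hc
  have hcj : c j = 1 := by simp [hc]
  have hci : ∀ i, i ≠ j → c i = 0 := fun i hi => by simp [hc, hi]
  have hspan := energyForm_span hf c
  have e1 : (fun x => ∑ i, c i * f i x) = f j := by
    funext x
    rw [Finset.sum_eq_single j (fun i _ hi => by rw [hci i hi, zero_mul]) (fun h => absurd (Finset.mem_univ j) h),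
      hcj, one_mul]
  have e2 : ∑ i, c i ^ 2 * physLevel ((i : ℕ) + 1) = physLevel ((j : ℕ) + 1) := by
    rw [Finset.sum_eq_single j (fun i _ hi => by rw [hci i hi]; ring) (fun h => absurd (Finset.mem_univ j) h), hcj]
    ring
  rw [e1, e2] at hspan
  have hG : Integrable fun x => ‖gradient (f j) x‖ ^ 2 := by
    refine (integrable_finsetSum Finset.univ fun p _ => hK.integrable_pderiv_sq p).congr (Eventually.of_forall fun x => ?_)
    show ∑ p, pderiv p (f j) x ^ 2 = ‖gradient (f j) x‖ ^ 2
    exact (norm_gradient_sq _ x).symm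
  have hEq : energyForm (f j) = (1 / 2 : ℝ) * (∫ x, ‖gradient (f j) x‖ ^ 2) + ∫ x, luscherPotential x * f j x ^ 2 := by
    rw [energyForm, integral_add (hG.const_mul _) hK.integrable_potential_sq, integral_const_mul]
  have hV0 : 0 ≤ ∫ x, luscherPotential x * f j x ^ 2 :=
    integral_nonneg fun x => mul_nonneg (luscherPotential_nonneg x) (sq_nonneg _)
  have hgrad : ∫ z, ‖fderiv ℝ (f j) z‖ ^ 2 = ∫ x, ‖gradient (f j) x‖ ^ 2 :=
    integral_congr_ae (Eventually.of_forall fun x => by simp only [norm_gradient_eq_norm_fderiv])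
  rw [hgrad]
  linarith [hEq.symm.trans hspan]

/-- The exposed budget is at most `½ (m+1) · L` when every level of the family is `≤ L`. [cite: ReedSimonIV1978, Thm. XIII.64] -/
theorem budget_le {m : ℕ} {f : Fin (m + 1) → ZM → ℝ} (hf : IsEigenFamily m f) {L : ℝ}
    (hL : ∀ j : Fin (m + 1), physLevel ((j : ℕ) + 1) ≤ L) :
    (1 / 4 : ℝ) * ∑ j, ∫ z, ‖fderiv ℝ (f j) z‖ ^ 2 ≤ (1 / 2 : ℝ) * ((m : ℝ) + 1) * L := by
  have h : ∑ j, ∫ z, ‖fderiv ℝ (f j) z‖ ^ 2 ≤ ∑ _j : Fin (m + 1), 2 * L :=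
    Finset.sum_le_sum fun j _ => (integral_norm_fderiv_sq_le hf j).trans (by linarith [hL j])
  rw [Finset.sum_const, Finset.card_univ, Fintype.card_fin, nsmul_eq_mul] at h
  push_cast at h
  linarith

/-! ## 3. III.10 in count mode: no span component, explicit threshold -/

/-- **III.10, count mode.**  Let `E ≥ 0`, `κ`, `E + 96κ² + 3 ≤ physLevel (m+2)`, `Θ = ¼ Σ_j ∫‖∇f_j‖²`,
`E'' = E + 96κ² + 3`.  For `0 < t ≤ 1` with `t (E''Θ + 64 + (E+2)E'' + 1) ≤ 1` and every datum `g` (measurable, bounded,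
colour-invariant, supported in `‖x‖ ≤ κ/√t`) orthogonal to the WHOLE family: `(E + 2) ∫ g² ≤ kacForm t g`.
(Proof = `kacForm_remainder_ge` with `c = 0`, the exposed budget, and `physLevel (m+2)` replaced by `E''` in the min–max
step, legitimate because that step uses the level only from below and `𝔮 ≥ 0`.) [cite: SimonB1983DiscreteSpectrum, §3] -/
theorem kacForm_remainder_count {m : ℕ} {f : Fin (m + 1) → ZM → ℝ} (hf : IsEigenFamily m f) {E κ : ℝ} (hE : 0 ≤ E)
    (hgap : E + 96 * κ ^ 2 + 3 ≤ physLevel (m + 2)) {t : ℝ} (ht : 0 < t) (ht1 : t ≤ 1)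
    (htd : t * ((E + 96 * κ ^ 2 + 3) * ((1 / 4 : ℝ) * ∑ j, ∫ z, ‖fderiv ℝ (f j) z‖ ^ 2) + 64 +
      (E + 2) * (E + 96 * κ ^ 2 + 3) + 1) ≤ 1)
    (g : ZM → ℝ) (M : ℝ) (hgm : Measurable g) (hgb : ∀ x, |g x| ≤ M) (hginv : IsGaugeInv g)
    (hsupp : ∀ x, g x ≠ 0 → ‖x‖ ≤ κ / Real.sqrt t) (horth : ∀ j, ∫ x, g x * f j x = 0) :
    (E + 2) * ∫ x, g x ^ 2 ≤ kacForm t g := by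
  set Θ : ℝ := (1 / 4 : ℝ) * ∑ j, ∫ z, ‖fderiv ℝ (f j) z‖ ^ 2 with hΘdef
  set E'' : ℝ := E + 96 * κ ^ 2 + 3 with hE''def
  have hΘ0 : 0 ≤ Θ := by
    rw [hΘdef]; exact mul_nonneg (by norm_num) (Finset.sum_nonneg fun j _ => integral_nonneg fun z => sq_nonneg _)
  have hE''0 : 0 ≤ E'' := by rw [hE''def]; positivity
  obtain ⟨M₂, hM₂0, hM₂⟩ := integral_norm_sq_mul_eigSpan_sq_le hf
  let c : Fin (m + 1) → ℝ := fun _ => 0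
  have hc : ∀ j, c j = ∫ x, g x * f j x := fun j => (horth j).symm
  obtain ⟨hrm, ⟨M', hrb⟩, hri, hrinv, hrw, hrV, -, horth', -⟩ := remainder_package hf hgm hgb hsupp hginv c hc
  obtain ⟨hF2i, hF2le⟩ := hM₂ c
  have hr2 : Integrable fun x => (g - eigSpan f c) x ^ 2 := integrable_sq_of_bounded_integrable hrm hrb hri
  have hx2 : Integrable fun x => ‖x‖ ^ 2 * (g - eigSpan f c) x ^ 2 := by
    refine hrw.mono' ((continuous_norm.pow 2).measurable.mul (hrm.pow_const 2)).aestronglyMeasurable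
      (Eventually.of_forall fun x => ?_)
    rw [Real.norm_of_nonneg (mul_nonneg (sq_nonneg _) (sq_nonneg _))]
    have : ‖x‖ ^ 2 ≤ 1 + ‖x‖ ^ 4 := by nlinarith [sq_nonneg (‖x‖ ^ 2 - 1)]
    exact mul_le_mul_of_nonneg_right this (sq_nonneg _)
  have hEU := energyForm_heatSmooth_half_le ht hrm hrb hri hrinv hrw hrV
  have hmom := moment_split ht hsupp hr2 hx2 hF2i
  have hlow := physLevel_mul_le_energyForm_heatSmooth hf ht hrm hrb hri hrinv hrw
    (sum_sq_integral_heatSmooth_mul_le_explicit hf t ht _ hrm M' hrb hri horth')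
  have hX0 : 0 ≤ ∫ x, (g - eigSpan f c) x ^ 2 := integral_nonneg fun x => sq_nonneg _
  have hS0 : (0 : ℝ) ≤ ∑ j, c j ^ 2 := Finset.sum_nonneg fun j _ => sq_nonneg _
  have hmom' : t * ∫ x, ‖x‖ ^ 2 * (g - eigSpan f c) x ^ 2 ≤
      κ ^ 2 * (∫ x, (g - eigSpan f c) x ^ 2) + t * (M₂ * ∑ j, c j ^ 2) :=
    hmom.trans (by nlinarith [mul_le_mul_of_nonneg_left hF2le ht.le])
  -- replace `physLevel (m+2)` by `E''` in the min–max step (used only from below; `𝔮 ≥ 0`)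
  have hlow' : E'' * ((∫ x, (g - eigSpan f c) x ^ 2) - t * kacForm t (g - eigSpan f c) -
      t * Θ * ∫ x, (g - eigSpan f c) x ^ 2) ≤ energyForm (heatSmooth (t / 2) (g - eigSpan f c)) := by
    rcases le_or_gt 0 ((∫ x, (g - eigSpan f c) x ^ 2) - t * kacForm t (g - eigSpan f c) -
        t * Θ * ∫ x, (g - eigSpan f c) x ^ 2) with hb | hb
    · exact (mul_le_mul_of_nonneg_right hgap hb).trans hlow
    · exact (mul_nonpos_iff.2 (Or.inl ⟨hE''0, hb.le⟩)).trans (energyForm_nonneg _)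
  have hmain := remainder_arith (E := E) (κ := κ) hE''0 hX0 hS0 hM₂0 ht ht1 htd le_rfl hEU hmom' hlow'
  -- no span component: `c = 0`, `r = g`
  have hr : g - eigSpan f c = g := by
    funext x
    simp [eigSpan, c]
  have hS : ∑ j, c j ^ 2 = 0 := by simp [c]
  rw [hS, hr] at hmain
  linarith

/-! ## 4. The minimal window index and its count -/

/-- For every `A` there is a window index `m` with `A ≤ physLevel (m+2)`, all levels of the family `f_0,…,f_m` at most
`max (physLevel 1) A`, and — if `0 ≤ A` — `m ≤ dimBound A`. [cite: SimonB1983DiscreteSpectrum, Cor. 4] -/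
theorem exists_window_index (A : ℝ) (hA : 0 ≤ A) :
    ∃ m : ℕ, A ≤ physLevel (m + 2) ∧ (∀ j : Fin (m + 1), physLevel ((j : ℕ) + 1) ≤ max (physLevel 1) A) ∧
      (m : ℝ) ≤ dimBound A := by
  classical
  have hex : ∃ N : ℕ, A ≤ physLevel (N + 2) := by
    obtain ⟨N, hN⟩ := tendsto_atTop_atTop.1 tendsto_physLevel_atTop A
    exact ⟨N, hN _ (Nat.le_add_right _ _)⟩
  refine ⟨Nat.find hex, Nat.find_spec hex, fun j => ?_, ?_⟩
  · rcases Nat.eq_zero_or_pos (j : ℕ) with hj | hj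
    · rw [hj]; exact le_max_left _ _
    · have hlt : (j : ℕ) - 1 < Nat.find hex := by have := j.2; omega
      have h := Nat.find_min hex hlt
      have e : (j : ℕ) - 1 + 2 = (j : ℕ) + 1 := by omega
      rw [e] at h
      exact (not_le.mp h).le.trans (le_max_right _ _)
  · rcases Nat.eq_zero_or_pos (Nat.find hex) with h0 | hpos
    · rw [h0]; simpa using dimBound_nonneg A
    · have hlt : Nat.find hex - 1 < Nat.find hex := by omega
      have h := Nat.find_min hex hlt
      have e : Nat.find hex - 1 + 2 = Nat.find hex + 1 := by omega
      rw [e] at h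
      by_contra hlt'
      have hk : dimBound A < ((Nat.find hex + 1 : ℕ) : ℝ) := by push_cast; linarith [not_le.mp hlt']
      exact h (le_physLevel_of_dimBound_lt hA hk)

/-! ## 5. «DimBoundPoly» → «FlatKacCount» (κ = 7, deficit constant `C' = 0`) -/

/-- **The flat Kac-form count from the polynomial dimension bound.**  [cite: SimonB1983DiscreteSpectrum, §3]
[cite: ReedSimonIV1978, Thm. XIII.64] -/
theorem flatKacCount_of_dimBoundPoly
    (hdim : ∃ Cd : ℝ, ∃ pd : ℕ, 0 < Cd ∧ ∀ E : ℝ, 0 ≤ E → dimBound E ≤ Cd * (1 + E) ^ pd) :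
    ∃ C : ℝ, ∃ p : ℕ, ∃ C' : ℝ, ∃ q : ℕ, ∃ c₀ : ℝ, 0 < C ∧ 0 < c₀ ∧ ∀ E : ℝ, 0 ≤ E →
      ∃ n : ℕ, (n : ℝ) ≤ C * (1 + E) ^ p ∧ ∃ fs : Fin n → ZM → ℝ,
        (∀ i, Continuous (fs i)) ∧ (∀ i, ∃ M : ℝ, ∀ x, |fs i x| ≤ M) ∧ (∀ i, IsGaugeInv (fs i)) ∧ (∀ i, Integrable (fs i)) ∧
        ∀ t : ℝ, 0 < t → (1 + E) ^ q * t ≤ c₀ → ∀ g : ZM → ℝ, Measurable g → (∃ M : ℝ, ∀ x, |g x| ≤ M) → IsGaugeInv g →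
          (∀ x, g x ≠ 0 → ‖x‖ ≤ 7 / Real.sqrt t) → (∀ i, ∫ x, g x * fs i x = 0) →
          (E - C' * (1 + E) ^ q * t) * ∫ x, g x ^ 2 ≤ kacForm t g := by
  obtain ⟨Cd, pd, hCd, hdimle⟩ := hdim
  have hL1 : 0 ≤ physLevel 1 := physLevel_nonneg le_rfl
  -- constants
  set C : ℝ := Cd * 4708 ^ pd + 1 with hCdef
  have hC0 : 0 < C := by
    rw [hCdef]; exact add_pos_of_nonneg_of_pos (mul_nonneg hCd.le (pow_nonneg (by norm_num) _)) one_pos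
  set K : ℝ := 4707 * ((1 / 2 : ℝ) * C * (physLevel 1 + 4707)) + 64 + 2 * 4707 + 1 with hKdef
  have hK0 : 0 < K := by
    rw [hKdef]; nlinarith [hC0, hL1, mul_nonneg hC0.le hL1]
  refine ⟨C, pd, 0, pd + 2, min 1 (1 / K), hC0, lt_min one_pos (div_pos one_pos hK0), fun E hE => ?_⟩
  have h1E : 1 ≤ 1 + E := by linarith
  -- the window and the family
  obtain ⟨m, hgap, hlev, hmle⟩ := exists_window_index (E + 4707) (by positivity)
  obtain ⟨f, hf⟩ := isEigenFamily_of_AL1 m (LuscherHamiltonianEigenfunctions_holds m)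
  have h4707 : (96 : ℝ) * 7 ^ 2 + 3 = 4707 := by norm_num
  have hgap' : E + 96 * (7 : ℝ) ^ 2 + 3 ≤ physLevel (m + 2) := by linarith [hgap, h4707]
  -- the count `m + 1 ≤ C (1+E)^pd`
  have hpow1 : (1 : ℝ) ≤ (1 + E) ^ pd := one_le_pow₀ h1E
  have hdimE : dimBound (E + 4707) ≤ Cd * 4708 ^ pd * (1 + E) ^ pd := by
    have h := hdimle (E + 4707) (by positivity)
    have h2 : (1 + (E + 4707)) ^ pd ≤ (4708 * (1 + E)) ^ pd :=
      pow_le_pow_left₀ (by positivity) (by linarith) pd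
    calc dimBound (E + 4707) ≤ Cd * (1 + (E + 4707)) ^ pd := h
      _ ≤ Cd * (4708 * (1 + E)) ^ pd := mul_le_mul_of_nonneg_left h2 hCd.le
      _ = Cd * 4708 ^ pd * (1 + E) ^ pd := by rw [mul_pow]; ring
  have hcount : ((m + 1 : ℕ) : ℝ) ≤ C * (1 + E) ^ pd := by
    push_cast
    rw [hCdef]
    nlinarith [hmle, hdimE, hpow1]
  -- the budget bound `Θ ≤ ½ C (L₁ + 4707) (1+E)^(pd+1)`
  have hlevL : ∀ j : Fin (m + 1), physLevel ((j : ℕ) + 1) ≤ physLevel 1 + 4707 + E := fun j =>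
    (hlev j).trans (max_le (by linarith) (by linarith))
  have hΘ := budget_le hf hlevL
  have hm1 : (m : ℝ) + 1 ≤ C * (1 + E) ^ pd := by exact_mod_cast hcount
  have hLE : physLevel 1 + 4707 + E ≤ (physLevel 1 + 4707) * (1 + E) := by nlinarith
  have hΘ' : (1 / 4 : ℝ) * ∑ j, ∫ z, ‖fderiv ℝ (f j) z‖ ^ 2 ≤
      (1 / 2 : ℝ) * C * (physLevel 1 + 4707) * (1 + E) ^ (pd + 1) := by
    have hL0 : 0 ≤ physLevel 1 + 4707 + E := by positivity
    calc (1 / 4 : ℝ) * ∑ j, ∫ z, ‖fderiv ℝ (f j) z‖ ^ 2 ≤ (1 / 2 : ℝ) * ((m : ℝ) + 1) * (physLevel 1 + 4707 + E) := hΘ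
      _ ≤ (1 / 2 : ℝ) * (C * (1 + E) ^ pd) * ((physLevel 1 + 4707) * (1 + E)) :=
          mul_le_mul (mul_le_mul_of_nonneg_left hm1 (by norm_num)) hLE hL0
            (mul_nonneg (by norm_num) (mul_nonneg hC0.le (pow_nonneg (by linarith) _)))
      _ = (1 / 2 : ℝ) * C * (physLevel 1 + 4707) * (1 + E) ^ (pd + 1) := by ring
  -- the threshold denominator is `≤ K (1+E)^(pd+2)`
  have hpow_mono : ∀ a b : ℕ, a ≤ b → (1 + E) ^ a ≤ (1 + E) ^ b := fun a b hab => pow_le_pow_right₀ h1E hab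
  have hden : (E + 96 * (7 : ℝ) ^ 2 + 3) * ((1 / 4 : ℝ) * ∑ j, ∫ z, ‖fderiv ℝ (f j) z‖ ^ 2) + 64 +
      (E + 2) * (E + 96 * (7 : ℝ) ^ 2 + 3) + 1 ≤ K * (1 + E) ^ (pd + 2) := by
    have hA : E + 96 * (7 : ℝ) ^ 2 + 3 ≤ 4707 * (1 + E) := by linarith [h4707]
    have hA0 : 0 ≤ E + 96 * (7 : ℝ) ^ 2 + 3 := by positivity
    have hΘ0 : 0 ≤ (1 / 4 : ℝ) * ∑ j, ∫ z, ‖fderiv ℝ (f j) z‖ ^ 2 :=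
      mul_nonneg (by norm_num) (Finset.sum_nonneg fun j _ => integral_nonneg fun z => sq_nonneg _)
    have t1 : (E + 96 * (7 : ℝ) ^ 2 + 3) * ((1 / 4 : ℝ) * ∑ j, ∫ z, ‖fderiv ℝ (f j) z‖ ^ 2) ≤
        4707 * ((1 / 2 : ℝ) * C * (physLevel 1 + 4707)) * (1 + E) ^ (pd + 2) := by
      calc (E + 96 * (7 : ℝ) ^ 2 + 3) * ((1 / 4 : ℝ) * ∑ j, ∫ z, ‖fderiv ℝ (f j) z‖ ^ 2)
          ≤ (4707 * (1 + E)) * ((1 / 2 : ℝ) * C * (physLevel 1 + 4707) * (1 + E) ^ (pd + 1)) :=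
            mul_le_mul hA hΘ' hΘ0 (by positivity)
        _ = 4707 * ((1 / 2 : ℝ) * C * (physLevel 1 + 4707)) * (1 + E) ^ (pd + 2) := by ring
    have hq1 : (1 : ℝ) ≤ (1 + E) ^ (pd + 2) := one_le_pow₀ h1E
    have t2 : (64 : ℝ) ≤ 64 * (1 + E) ^ (pd + 2) := by linarith [hq1]
    have t3 : (E + 2) * (E + 96 * (7 : ℝ) ^ 2 + 3) ≤ 2 * 4707 * (1 + E) ^ (pd + 2) := by
      have h2 : (E + 2) * (E + 96 * (7 : ℝ) ^ 2 + 3) ≤ (2 * (1 + E)) * (4707 * (1 + E)) :=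
        mul_le_mul (by linarith) hA hA0 (by positivity)
      have h3 : (1 + E) ^ 2 ≤ (1 + E) ^ (pd + 2) := hpow_mono 2 (pd + 2) (by omega)
      nlinarith [h2, h3]
    have t4 : (1 : ℝ) ≤ 1 * (1 + E) ^ (pd + 2) := by linarith [hq1]
    rw [hKdef]
    nlinarith [t1, t2, t3, t4]
  refine ⟨m + 1, hcount, f, fun i => (hf.1 _ 0).continuous, fun i => (hf.2.2.2.2 _).abs_le, fun i => hf.2.1 _,
    fun i => (isKacFn_of_isEigenFamily hf _).integrable, fun t ht htc g hgm hgM hginv hsupp horth => ?_⟩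
  obtain ⟨M, hgM⟩ := hgM
  have hqpow : (1 : ℝ) ≤ (1 + E) ^ (pd + 2) := one_le_pow₀ h1E
  have htle : t ≤ (1 + E) ^ (pd + 2) * t := by
    have := mul_le_mul_of_nonneg_right hqpow ht.le; linarith
  have ht1 : t ≤ 1 := (htle.trans htc).trans (min_le_left _ _)
  have htK : (1 + E) ^ (pd + 2) * t ≤ 1 / K := htc.trans (min_le_right _ _)
  have htd : t * ((E + 96 * (7 : ℝ) ^ 2 + 3) * ((1 / 4 : ℝ) * ∑ j, ∫ z, ‖fderiv ℝ (f j) z‖ ^ 2) + 64 +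
      (E + 2) * (E + 96 * (7 : ℝ) ^ 2 + 3) + 1) ≤ 1 := by
    have h1 : t * (K * (1 + E) ^ (pd + 2)) ≤ 1 := by
      have : K * ((1 + E) ^ (pd + 2) * t) ≤ K * (1 / K) := mul_le_mul_of_nonneg_left htK hK0.le
      rw [mul_one_div_cancel hK0.ne'] at this
      linarith
    exact (mul_le_mul_of_nonneg_left hden ht.le).trans h1
  have hmain := kacForm_remainder_count hf hE hgap' ht ht1 htd g M hgm hgM hginv hsupp horth
  have hX0 : 0 ≤ ∫ x, g x ^ 2 := integral_nonneg fun x => sq_nonneg _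
  have e0 : (E - 0 * (1 + E) ^ (pd + 2) * t) * ∫ x, g x ^ 2 = E * ∫ x, g x ^ 2 := by ring
  rw [e0]
  nlinarith [hmain, hX0]

/-! ## 6. «DimBoundPoly» is a theorem (Euclidean ball volumes), hence «FlatKacCount» -/

/-- `dim ℝ⁹ = 9` for the configuration space `ZM = EuclideanSpace ℝ (Fin 3 × Fin 3)`. [folklore] -/
theorem finrank_ZM : Module.finrank ℝ ZM = 9 := by
  rw [finrank_euclideanSpace]
  simp

/-- Euclidean ball volumes scale with the ninth power of the radius. [folklore] -/
theorem volume_closedBall_toReal (r : ℝ) (hr : 0 ≤ r) :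
    (volume (Metric.closedBall (0 : ZM) r)).toReal = r ^ 9 * (volume (Metric.closedBall (0 : ZM) 1)).toReal := by
  rw [Measure.addHaar_closedBall' volume (0 : ZM) hr, finrank_ZM, ENNReal.toReal_mul, ENNReal.toReal_ofReal (pow_nonneg hr _)]

/-- **«DimBoundPoly»**: the explicit dimension bound `N(E)` of the Literature (`dimBound`, a ratio of two Euclidean ball
volumes times 8) is polynomial in the energy: `N(E) = 8 (24E/δ(E) + 16)⁹ ≤ 8·48⁹ (1+E)¹⁸` (`1/δ(E) = 2(√(2E)+1)`,
`√(2E) ≤ E + ½`). [cite: SimonB1983DiscreteSpectrum, Cor. 4] -/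
theorem dimBound_le_poly : ∃ Cd : ℝ, ∃ pd : ℕ, 0 < Cd ∧ ∀ E : ℝ, 0 ≤ E → dimBound E ≤ Cd * (1 + E) ^ pd := by
  refine ⟨8 * 48 ^ 9, 18, by positivity, fun E hE => ?_⟩
  have hδ0 : 0 < mollScale E := mollScale_pos E
  set δ : ℝ := mollScale E with hδ
  set v : ℝ := (volume (Metric.closedBall (0 : ZM) 1)).toReal with hv
  have hv0 : 0 < v :=
    ENNReal.toReal_pos (Metric.measure_closedBall_pos volume (0 : ZM) one_pos).ne' measure_closedBall_lt_top.ne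
  have hreal : (volume : Measure ZM).real (Metric.closedBall (0 : ZM) (δ / 2)) = (δ / 2) ^ 9 * v := by
    rw [measureReal_def, volume_closedBall_toReal _ (by positivity)]
  have hbig : (volume (Metric.closedBall (0 : ZM) (2 * (6 * E + 4 * δ)))).toReal = (2 * (6 * E + 4 * δ)) ^ 9 * v :=
    volume_closedBall_toReal _ (by positivity)
  -- `√(2E) ≤ E + ½` and `δ (2(√(2E)+1)) = 1`
  have hs0 : 0 ≤ Real.sqrt (2 * E) := Real.sqrt_nonneg _
  have hs : Real.sqrt (2 * E) ≤ E + 1 / 2 := by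
    have h : 2 * E ≤ (E + 1 / 2) ^ 2 := by nlinarith [sq_nonneg (E - 1 / 2)]
    calc Real.sqrt (2 * E) ≤ Real.sqrt ((E + 1 / 2) ^ 2) := Real.sqrt_le_sqrt h
      _ = E + 1 / 2 := Real.sqrt_sq (by positivity)
  have hδE : δ * (2 * (Real.sqrt (2 * E) + 1)) = 1 := by
    rw [hδ, mollScale]
    field_simp
  have hab : 2 * (6 * E + 4 * δ) ≤ 48 * (1 + E) ^ 2 * (δ / 2) := by
    have h1 : 12 * E = 24 * (E * δ * Real.sqrt (2 * E)) + 24 * (E * δ) := by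
      have h : 12 * E * (δ * (2 * (Real.sqrt (2 * E) + 1))) = 12 * E * 1 := by rw [hδE]
      linarith [h]
    have h2 : E * δ * Real.sqrt (2 * E) ≤ E * δ * (E + 1 / 2) :=
      mul_le_mul_of_nonneg_left hs (by positivity)
    nlinarith [h1, h2, mul_nonneg hE hδ0.le, hδ0.le, mul_nonneg (mul_nonneg hE hE) hδ0.le]
  have ha0 : 0 ≤ 2 * (6 * E + 4 * δ) := by positivity
  have hpow : (2 * (6 * E + 4 * δ)) ^ 9 ≤ (48 * (1 + E) ^ 2 * (δ / 2)) ^ 9 := pow_le_pow_left₀ ha0 hab 9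
  unfold dimBound
  rw [← hδ, hreal, hbig]
  have hb9 : 0 < (δ / 2) ^ 9 * v := by positivity
  have e : 2 * (4 * (1 / ((δ / 2) ^ 9 * v))) * ((2 * (6 * E + 4 * δ)) ^ 9 * v) =
      8 * (2 * (6 * E + 4 * δ)) ^ 9 * v / ((δ / 2) ^ 9 * v) := by
    field_simp
    ring
  rw [e, div_le_iff₀ hb9]
  calc 8 * (2 * (6 * E + 4 * δ)) ^ 9 * v ≤ 8 * (48 * (1 + E) ^ 2 * (δ / 2)) ^ 9 * v := by
        apply mul_le_mul_of_nonneg_right _ hv0.le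
        exact mul_le_mul_of_nonneg_left hpow (by norm_num)
    _ = 8 * 48 ^ 9 * (1 + E) ^ 18 * ((δ / 2) ^ 9 * v) := by ring

/-- ★★ **«FlatKacCount» (κ = 7)** — the flat Kac-form count on the inner ball with polynomially many constraints, polynomial
validity range and deficit constant `0`: the single analytic input of the count-mode INNER lane of `OneSiteTail`
(`OSTailInner.innerCount_of_flatKacCount`). [cite: SimonB1983DiscreteSpectrum, §3] [cite: ReedSimonIV1978, Thm. XIII.64] -/
theorem flatKacCount :
    ∃ C : ℝ, ∃ p : ℕ, ∃ C' : ℝ, ∃ q : ℕ, ∃ c₀ : ℝ, 0 < C ∧ 0 < c₀ ∧ ∀ E : ℝ, 0 ≤ E →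
          ∃ n : ℕ, (n : ℝ) ≤ C * (1 + E) ^ p ∧ ∃ fs : Fin n → ZM → ℝ,
            (∀ i, Continuous (fs i)) ∧ (∀ i, ∃ M : ℝ, ∀ x, |fs i x| ≤ M) ∧ (∀ i, IsGaugeInv (fs i)) ∧ (∀ i, Integrable (fs i)) ∧
            ∀ t : ℝ, 0 < t → (1 + E) ^ q * t ≤ c₀ → ∀ g : ZM → ℝ, Measurable g → (∃ M : ℝ, ∀ x, |g x| ≤ M) → IsGaugeInv g →
              (∀ x, g x ≠ 0 → ‖x‖ ≤ 7 / Real.sqrt t) → (∀ i, ∫ x, g x * fs i x = 0) →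
              (E - C' * (1 + E) ^ q * t) * ∫ x, g x ^ 2 ≤ kacForm t g :=
  flatKacCount_of_dimBoundPoly dimBound_le_poly

end Summit.QuantumFields.YangMills.Theorems.FemtoTransferGap.OSTailFlat

end
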